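import Mathlib
import Literature.NumberTheory.LFunctions.Zhang2022.Section3Lemma34
import Literature.NumberTheory.LFunctions.Zhang2022.TypedSection03
import HarnessLib

/-!
# Zhang (2022) §3: the two inner claims of the Lemma 3.4 block (`Z22:§3.u017`, `Z22:§3.u019`) DISCHARGED

Topic `Literature/NumberTheory/LFunctions/Zhang2022` (Landau–Siegel adjudication tree; verdict-neutral;
cell siegel-zhang, DAG nodes `Z22:§3.u017`, `Z22:§3.u019`).
Y. Zhang, *Discrete mean estimates and the Landau–Siegel zero*, arXiv:2211.02515v1 (2022)
[Zhang2022LandauSiegel] — **an unrefereed manuscript under adjudication; nothing here bears on its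
Theorems 1–2 or on Landau–Siegel zeros.** §3 p. 15 (tex L801–L811):

> By (3.1) we may write `F(s,ψ)²⁰ = Σ_{n≤D⁸⁰} ν₂₀(n)ψ(n)n^{−s}`, `G(s,ψ)²⁰ = Σ_{n≤D⁸⁰} υ₂₀(n)ψ(n)n^{−s}`
> with `|ν₂₀(n)| ≤ τ₄₀(n)`, `|υ₂₀(n)| ≤ τ₄₀(n)`. […] By Cauchy's inequality and the first assertion of
> Lemma 3.3 we obtain
> `Σ_{ψ∈Ψ} (|X₁(D⁸⁰,ψ)| + |X₂(D⁸⁰,ψ)| + ∫₁^{D⁸⁰} (|X₁(x,ψ)| + |X₂(x,ψ)|) dx/x)² ≪ 𝔓𝓛¹⁶⁰²`.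

The §3 typed file (`TypedSection03`) states these as the CLAIM nodes `Section3.Step3u017`,
`Section3.Step3u019` (the deduction node `Section3.Ded34 : Step3u019 → Skeleton.Lemma34` and its proof
`Section3.ded34_holds` are L1-t4's, `TypedSection03Edges`). This file PROVES the two step claims
(theorems only; no new definition, no named fact):

* `Section3.step3u017_holds` — `Z22:§3.u017`: the finite Dirichlet-polynomial identities for `F²⁰`, `G²⁰`
  via `Lemma34.sum_pow_eq_sum_convPow` (a Dirichlet polynomial with coefficients supported on `n ≤ N`
  and a completely multiplicative twist, raised to the `k`-th power, is the Dirichlet polynomial of the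
  `k`-fold convolution power, supported on `n ≤ Nᵏ`; Mathlib's `LSeries_convolution'` on finitely
  supported series), and `|ν₂₀|, |υ₂₀| ≤ τ₄₀` (`Lemma34.norm_nu20_le`, `norm_ups20_le` of
  `Section3Lemma34`, with `MeanSquareMajorant.tau 40 n = Section3.tauK 40 n`);
* `Section3.step3u019_holds` — `Z22:§3.u019` with `C = 8·6401·majorantConst 1600 80·80¹⁶⁰⁰`: the
  two-sequence moment bound `Lemma34.moment_pair_le` (Lemma 3.3 (i) + Cauchy–Schwarz) and the
  coefficient moments `Lemma34.coeff_moment_le` of `Section3Lemma34`.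

## References

* Y. Zhang, arXiv:2211.02515v1 (2022), §3 p. 15 (tex L801–L824). [cite: Zhang2022LandauSiegel, §3 Lemma 3.4 p. 15]
-/

noncomputable section

open Finset

namespace Literature.NumberTheory.LFunctions.Zhang2022

/-! ### Finite Dirichlet polynomials: powers are convolution powers -/

namespace Lemma34

open scoped LSeries.notation

/-- Twisting by a completely multiplicative `c` commutes with Dirichlet convolution:
`(f·c) ⍟ (g·c) = (f ⍟ g)·c`. [folklore] -/
private theorem convolution_mul_mul (f g c : ℕ → ℂ) (hc : ∀ m n, c (m * n) = c m * c n) :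
    (fun n => f n * c n) ⍟ (fun n => g n * c n) = fun n => (f ⍟ g) n * c n := by
  funext n
  rw [LSeries.convolution_def, LSeries.convolution_def]
  simp only [Finset.sum_mul]
  refine Finset.sum_congr rfl fun p hp => ?_
  rw [← (Nat.mem_divisorsAntidiagonal.mp hp).1, hc]
  ring

/-- The convolution powers of a twisted sequence are the twisted convolution powers (`c` completely
multiplicative with `c(1) = 1`). [folklore] -/
private theorem convPow_mul (a c : ℕ → ℂ) (hc : ∀ m n, c (m * n) = c m * c n) (hc1 : c 1 = 1) :
    ∀ k, Skeleton.convPow (fun n => a n * c n) k = fun n => Skeleton.convPow a k n * c n := by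
  intro k
  induction k with
  | zero =>
    funext n
    simp only [Skeleton.convPow]
    split_ifs with h
    · rw [h, hc1, mul_one]
    · rw [zero_mul]
  | succ k ih =>
    show LSeries.convolution _ _ = fun n => LSeries.convolution _ _ n * c n
    rw [ih, convolution_mul_mul a (Skeleton.convPow a k) c hc]

/-- A convolution power of a sequence supported on `n ≤ N` is supported on `n ≤ Nᵏ`. [folklore] -/
private theorem convPow_eq_zero_of_lt {a : ℕ → ℂ} {N : ℕ} (ha : ∀ n, N < n → a n = 0) :
    ∀ k n, N ^ k < n → Skeleton.convPow a k n = 0 := by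
  intro k
  induction k with
  | zero =>
    intro n hn
    have h1 : n ≠ 1 := by rw [pow_zero] at hn; omega
    simp only [Skeleton.convPow, if_neg h1]
  | succ k ih =>
    intro n hn
    show LSeries.convolution _ _ n = 0
    rw [LSeries.convolution_def]
    refine Finset.sum_eq_zero fun p hp => ?_
    have hpn := (Nat.mem_divisorsAntidiagonal.mp hp).1
    by_cases h1 : N < p.1
    · rw [ha _ h1, zero_mul]
    · by_cases h2 : N ^ k < p.2
      · rw [ih _ h2, mul_zero]
      · exfalso
        push Not at h1 h2
        have : n ≤ N ^ k * N := hpn ▸ Nat.mul_le_mul h1 h2 |>.trans (by rw [mul_comm])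
        rw [pow_succ] at hn
        omega

/-- A finitely supported sequence has an everywhere (absolutely) convergent `L`-series, equal to the
finite Dirichlet polynomial `Σ_{n≤N} f(n)n^{−s}`. [folklore] -/
private theorem LSeries_eq_sum_of_support {f : ℕ → ℂ} {N : ℕ} (hf : ∀ n, N < n → f n = 0)
    (s : ℂ) : LSeriesSummable f s ∧ LSeries f s = ∑ n ∈ Icc 1 N, f n * (n : ℂ) ^ (-s) := by
  have hterm : ∀ n ∉ Icc 1 N, LSeries.term f s n = 0 := by
    intro n hn
    rw [mem_Icc, not_and_or, not_le, not_le] at hn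
    rcases hn with h | h
    · rw [Nat.lt_one_iff.mp h, LSeries.term_zero]
    · rw [LSeries.term_of_ne_zero (by omega), hf n h, zero_div]
  refine ⟨summable_of_ne_finset_zero hterm, ?_⟩
  rw [LSeries, tsum_eq_sum hterm]
  refine sum_congr rfl fun n hn => ?_
  rw [LSeries.term_of_ne_zero (by rw [mem_Icc] at hn; omega), div_eq_mul_inv, Complex.cpow_neg]

/-- **Powers of a finite Dirichlet polynomial.** For coefficients `a` supported on `n ≤ N` and a
completely multiplicative twist `c` with `c(1) = 1` (here `c(n) = ψ(n)`):
`(Σ_{n≤N} a(n)c(n)n^{−s})ᵏ = Σ_{n≤Nᵏ} a^{∗k}(n)c(n)n^{−s}` — the mechanism of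
"`F(s,ψ)²⁰ = Σ_{n≤D⁸⁰} ν₂₀(n)ψ(n)n^{−s}`". [cite: Zhang2022LandauSiegel, §3 p. 15] -/
theorem sum_pow_eq_sum_convPow (a c : ℕ → ℂ) (N : ℕ) (ha : ∀ n, N < n → a n = 0)
    (hc : ∀ m n, c (m * n) = c m * c n) (hc1 : c 1 = 1) (s : ℂ) (k : ℕ) :
    (∑ n ∈ Icc 1 N, a n * c n * (n : ℂ) ^ (-s)) ^ k =
      ∑ n ∈ Icc 1 (N ^ k), Skeleton.convPow a k n * c n * (n : ℂ) ^ (-s) := by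
  -- both sides are `L`-series of finitely supported sequences
  have hsuppk : ∀ k n, N ^ k < n → (fun n => Skeleton.convPow a k n * c n) n = 0 := fun k n hn => by
    show Skeleton.convPow a k n * c n = 0
    rw [convPow_eq_zero_of_lt ha k n hn, zero_mul]
  have hsupp1 : ∀ n, N < n → (fun n => a n * c n) n = 0 := fun n hn => by
    show a n * c n = 0
    rw [ha n hn, zero_mul]
  induction k with
  | zero =>
    rw [pow_zero, pow_zero, Finset.Icc_self, Finset.sum_singleton]
    simp [Skeleton.convPow, hc1]
  | succ k ih =>
    obtain ⟨hS1, hL1⟩ := LSeries_eq_sum_of_support hsupp1 s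
    obtain ⟨hSk, hLk⟩ := LSeries_eq_sum_of_support (hsuppk k) s
    obtain ⟨-, hLk1⟩ := LSeries_eq_sum_of_support (hsuppk (k + 1)) s
    rw [pow_succ, ih, mul_comm, ← hL1, ← hLk, ← LSeries_convolution' hS1 hSk, ← hLk1,
      ← convPow_mul a c hc hc1 k, ← convPow_mul a c hc hc1 (k + 1)]
    rfl

/-- The coercion `ArithmeticFunction ℕ → ArithmeticFunction ℝ` commutes with powers. [folklore] -/
private theorem natCoe_zeta_pow (j : ℕ) :
    ((ArithmeticFunction.zeta ^ j : ArithmeticFunction ℕ) : ArithmeticFunction ℝ) =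
      (ArithmeticFunction.zeta : ArithmeticFunction ℝ) ^ j := by
  induction j with
  | zero => rw [pow_zero, pow_zero, ArithmeticFunction.natCoe_one]
  | succ j ih => rw [pow_succ, pow_succ, ArithmeticFunction.natCoe_mul, ih]

/-- `MeanSquareMajorant.tau j` (`ζʲ` as a real arithmetic function) is the cast of `Section3.tauK j`
(`ζʲ` as an `ℕ`-valued arithmetic function). [folklore] -/
private theorem tau_eq_tauK (j n : ℕ) : MeanSquareMajorant.tau j n = (Section3.tauK j n : ℝ) := by
  rw [MeanSquareMajorant.tau, Section3.tauK, ← natCoe_zeta_pow, ArithmeticFunction.natCoe_apply]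

end Lemma34

/-! ### The two inner claims of the Lemma 3.4 block -/

namespace Section3

open Lemma34 Lemma36 MeanSquareMajorant

/-- **`Z22:§3.u017` HOLDS**: `F(s,ψ)²⁰ = Σ_{n≤D⁸⁰} ν₂₀(n)ψ(n)n^{−s}`, `G(s,ψ)²⁰ = Σ_{n≤D⁸⁰} υ₂₀(n)ψ(n)n^{−s}`
(finite Dirichlet-polynomial powers, `Lemma34.sum_pow_eq_sum_convPow` with `N = D⁴`, `k = 20`,
`c = ψ`), and `|ν₂₀(n)|, |υ₂₀(n)| ≤ τ₄₀(n)` (`Lemma34.norm_nu20_le`, `norm_ups20_le`). Unconditional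
(the hypothesis `χ` quadratic is not used). [cite: Zhang2022LandauSiegel, §3 p. 15] -/
theorem step3u017_holds : Step3u017 := by
  intro D _ χ x s _
  have hc : ∀ m n : ℕ, x.ψ ((m * n : ℕ) : ZMod x.p) = x.ψ (m : ZMod x.p) * x.ψ (n : ZMod x.p) :=
    fun m n => by rw [Nat.cast_mul, map_mul]
  have hc1 : x.ψ ((1 : ℕ) : ZMod x.p) = 1 := by rw [Nat.cast_one, map_one]
  have hpow : (D ^ 4) ^ 20 = D ^ 80 := by rw [← pow_mul]
  have htrunc : ∀ (a : ℕ → ℂ) (n : ℕ), D ^ 4 < n → Skeleton.trunc (D ^ 4) a n = 0 := fun a n hn => by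
    unfold Skeleton.trunc; rw [if_neg (by omega)]
  have hF : ∀ a : ℕ → ℂ,
      (∑ n ∈ Icc 1 (D ^ 4), a n * x.ψ (n : ZMod x.p) * (n : ℂ) ^ (-s)) ^ 20 =
        ∑ n ∈ Icc 1 (D ^ 80), Skeleton.convPow (Skeleton.trunc (D ^ 4) a) 20 n *
          x.ψ (n : ZMod x.p) * (n : ℂ) ^ (-s) := by
    intro a
    have h := sum_pow_eq_sum_convPow (Skeleton.trunc (D ^ 4) a) (fun n => x.ψ (n : ZMod x.p))
      (D ^ 4) (htrunc a) hc hc1 s 20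
    rw [hpow] at h
    rw [← h]
    congr 1
    refine sum_congr rfl fun n hn => ?_
    unfold Skeleton.trunc
    rw [if_pos (mem_Icc.mp hn).2]
  refine ⟨hF (Skeleton.nu χ), hF (Skeleton.ups χ), fun n => ⟨?_, ?_⟩⟩
  · rw [← tau_eq_tauK]; exact norm_nu20_le χ n
  · rw [← tau_eq_tauK]; exact norm_ups20_le χ n

/-- `log D ≥ 2` and `D ≥ 3` once `D ≥ ⌈e²⌉`. [folklore] -/
private theorem two_le_ell' {D : ℕ} (hD : ⌈Real.exp 2⌉₊ ≤ D) : 2 ≤ Skeleton.ell D ∧ 3 ≤ D := by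
  have h : Real.exp 2 ≤ D := le_trans (Nat.le_ceil _) (by exact_mod_cast hD)
  have h3 : (3 : ℝ) ≤ Real.exp 2 := by linarith [Real.add_one_le_exp (2 : ℝ)]
  exact ⟨(Real.le_log_iff_exp_le (lt_of_lt_of_le (Real.exp_pos _) h)).mpr h,
    by exact_mod_cast h3.trans h⟩

/-- For `𝓛 ≥ 2` every modulus `p ∼ P` exceeds `D⁸⁰` (`D⁸⁰ = e^{80𝓛} ≤ e^{𝓛⁹} = P < p`).
[cite: Zhang2022LandauSiegel, §2 (2.6)] -/
private theorem pow_eighty_lt_of_mem' {D p : ℕ} (hℓ : 2 ≤ Skeleton.ell D) (hD : 0 < D)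
    (hp : p ∈ Skeleton.primeWindow D) : D ^ 80 < p := by
  have hwin : ⌊Skeleton.bigP D⌋₊ < p := by
    simp only [Skeleton.primeWindow, Finset.mem_filter, Finset.mem_Ioo] at hp
    exact hp.1.1
  refine lt_of_le_of_lt (Nat.le_floor ?_) hwin
  have hD' : (0 : ℝ) < D := Nat.cast_pos.mpr hD
  rw [Nat.cast_pow, ← Real.exp_log (pow_pos hD' 80), Real.log_pow, Nat.cast_ofNat, Skeleton.bigP]
  apply Real.exp_le_exp.mpr
  have h8 : (2 : ℝ) ^ 8 ≤ Skeleton.ell D ^ 8 := pow_le_pow_left₀ (by norm_num) hℓ 8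
  calc (80 : ℝ) * Real.log D = 80 * Skeleton.ell D := rfl
    _ ≤ 2 ^ 8 * Skeleton.ell D := by nlinarith
    _ ≤ Skeleton.ell D ^ 8 * Skeleton.ell D := mul_le_mul_of_nonneg_right h8 (by linarith)
    _ = Skeleton.ell D ^ 9 := by ring

open scoped Classical in
/-- **`Z22:§3.u019` HOLDS** — the display before Lemma 3.4: for `D ≥ ⌈e²⌉` and any `χ`,
`Σ_{ψ∈Ψ} (|X₁(D⁸⁰,ψ)| + |X₂(D⁸⁰,ψ)| + ∫₁^{D⁸⁰}(|X₁| + |X₂|)dx/x)² ≤ C·𝔓·𝓛¹⁶⁰²` with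
`C = 8·6401·majorantConst 1600 80·80¹⁶⁰⁰`: the two-sequence moment `Lemma34.moment_pair_le` over the
window's moduli (`> D⁸⁰`), `Re s₀ = ½`, the coefficient moments `Lemma34.coeff_moment_le` (`≤ K𝓛¹⁶⁰⁰`,
`log D⁸⁰ = 80𝓛`), and `1 + 6400𝓛² ≤ 6401𝓛²`. [cite: Zhang2022LandauSiegel, §3 p. 15] -/
theorem step3u019_holds : Step3u019 := by
  obtain ⟨K, hKdef⟩ : ∃ K : ℝ, K = majorantConst 1600 80 * (80 : ℝ) ^ 1600 := ⟨_, rfl⟩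
  refine ⟨8 * 6401 * K, ⌈Real.exp 2⌉₊, fun D _ χ hD _hq _hp => ?_⟩
  dsimp only
  obtain ⟨hl2, hD3⟩ := two_le_ell' hD
  have hD0 : 0 < D := by omega
  set B : ℕ := D ^ 80 with hBdef
  have hB1 : 1 ≤ B := Nat.one_le_pow _ _ hD0
  have hB2 : 2 ≤ B := le_trans (by omega : 2 ≤ D) (Nat.le_self_pow (by norm_num) D)
  have hBreal : ((B : ℕ) : ℝ) = (D : ℝ) ^ 80 := by rw [hBdef, Nat.cast_pow]
  have hfloor : ⌊(D : ℝ) ^ 80⌋₊ = B := by rw [← hBreal, Nat.floor_natCast]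
  have hlogB : Real.log ((B : ℕ) : ℝ) = 80 * Skeleton.ell D := by
    rw [hBreal, Real.log_pow, Nat.cast_ofNat, Skeleton.ell]
  have hM : ∀ p ∈ Skeleton.primeWindow D, B < p := fun p hp => pow_eighty_lt_of_mem' hl2 hD0 hp
  have hIcc : ∀ N : ℕ, Icc 1 N = Ioc 0 N := fun N => by ext n; simp only [mem_Icc, mem_Ioc]; omega
  -- `lhs34` as a function of `(p, ψ)`
  have hlhs : ∀ x : Skeleton.Chr D, lhs34 χ x =
      ‖twist36 (Skeleton.nu20 χ) 0 (Skeleton.s0 D) x.ψ B‖ +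
        ‖twist36 (Skeleton.ups20 χ) 0 (Skeleton.s0 D) x.ψ B‖ +
        ∫ y in (1 : ℝ)..B, (‖twist36 (Skeleton.nu20 χ) 0 (Skeleton.s0 D) x.ψ ⌊y⌋₊‖ +
          ‖twist36 (Skeleton.ups20 χ) 0 (Skeleton.s0 D) x.ψ ⌊y⌋₊‖) / y := by
    intro x
    simp only [lhs34, Skeleton.X1, Skeleton.X2, twist36, hIcc, hfloor, hBreal]
  -- the second moment over `Ψ`
  have hs0 : (Skeleton.s0 D).re = 1 / 2 := by simp [Skeleton.s0, SmoothWeight.s0]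
  have hmom := moment_pair_le (Skeleton.nu20 χ) (Skeleton.ups20 χ) (Skeleton.s0 D) hB1
    (Skeleton.primeWindow D) hM
  rw [hs0, ← Skeleton.frakP_eq_sum_primeWindow] at hmom
  have hW1 := coeff_moment_le (norm_nu20_le χ) hB2
  have hW2 := coeff_moment_le (norm_ups20_le χ) hB2
  have hWK : majorantConst 1600 80 * Real.log ((B : ℕ) : ℝ) ^ 1600 = K * Skeleton.ell D ^ 1600 := by
    rw [hlogB, mul_pow, hKdef, mul_assoc]
  rw [hWK] at hW1 hW2
  clear hKdef hWK
  have h𝔓 : 0 ≤ frakP D :=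
    Skeleton.frakP_eq_sum_primeWindow D ▸ sum_nonneg fun p _ => Nat.cast_nonneg p
  have hT : 4 * (1 + Real.log ((B : ℕ) : ℝ) ^ 2) * frakP D *
      (∑ n ∈ Ioc 0 B, ‖Skeleton.nu20 χ n‖ ^ 2 * (n : ℝ) ^ (-(2 * (1 / 2 : ℝ))) +
        ∑ n ∈ Ioc 0 B, ‖Skeleton.ups20 χ n‖ ^ 2 * (n : ℝ) ^ (-(2 * (1 / 2 : ℝ)))) ≤
      8 * 6401 * K * frakP D * Skeleton.ell D ^ 1602 := by
    have h1 : 1 + (80 * Skeleton.ell D) ^ 2 ≤ 6401 * Skeleton.ell D ^ 2 := by nlinarith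
    rw [hlogB]
    calc 4 * (1 + (80 * Skeleton.ell D) ^ 2) * frakP D *
          (∑ n ∈ Ioc 0 B, ‖Skeleton.nu20 χ n‖ ^ 2 * (n : ℝ) ^ (-(2 * (1 / 2 : ℝ))) +
            ∑ n ∈ Ioc 0 B, ‖Skeleton.ups20 χ n‖ ^ 2 * (n : ℝ) ^ (-(2 * (1 / 2 : ℝ))))
        ≤ 4 * (6401 * Skeleton.ell D ^ 2) * frakP D * (2 * (K * Skeleton.ell D ^ 1600)) := by
          gcongr; linarith
      _ = 8 * 6401 * K * frakP D * Skeleton.ell D ^ 1602 := by ring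
  -- rewrite the sum over `Ψ` as the double sum
  haveI : Fintype (Skeleton.Chr D) := Fintype.ofFinite _
  rw [finsum_eq_sum_of_fintype, Fintype.sum_congr _ _ fun x => by rw [hlhs x],
    ← finsum_eq_sum_of_fintype,
    Skeleton.finsum_chr_eq D (fun p ψ =>
      (‖twist36 (Skeleton.nu20 χ) 0 (Skeleton.s0 D) ψ B‖ +
        ‖twist36 (Skeleton.ups20 χ) 0 (Skeleton.s0 D) ψ B‖ +
        ∫ y in (1 : ℝ)..B, (‖twist36 (Skeleton.nu20 χ) 0 (Skeleton.s0 D) ψ ⌊y⌋₊‖ +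
          ‖twist36 (Skeleton.ups20 χ) 0 (Skeleton.s0 D) ψ ⌊y⌋₊‖) / y) ^ 2)]
  exact hmom.trans hT

end Section3

end Literature.NumberTheory.LFunctions.Zhang2022

end
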